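import Mathlib
import HarnessLib
import Summits.Ventures.LatticeQCDFlow.Scaling.LatticeEntropySUN
import Summits.Ventures.LatticeQCDFlow.Scaling.LatticeEntropySUNBalls
import Summits.Ventures.LatticeQCDFlow.Scaling.LatticeEntropySUNHaarVolume

/-!
# LatticeQCDFlow / Scaling — the `SU(N)` entropy-growth law, unconditionally, for every `N ≥ 1`

HONEST FRAMING: exact (Metropolis-corrected) sampling algorithms for lattice gauge theory; figures of merit are
autocorrelation/cost numbers at stated couplings and volumes; no continuum-physics claim.

Venture `LatticeQCDFlow` (cell pub-lqcd), topic `Scaling`, FANOUT row 30 (lean-1) — OUR WORK, the assembly.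
Theory-2's `Scaling/LatticeEntropySUN.lean` / `LatticeEntropySUNBalls.lean` typed the `SU(N)` instance of the
entropy-growth law with the Haar-volume items `SUN.HaarActionBallLower N`, `SUN.HaarActionBallUpper N` as its
only inputs (`SUN.entropyGrowthLaw_of_haarActionBalls`); `Scaling/LatticeEntropySUNHaarVolume.lean` proved
both volume bounds for every `N ≥ 1`.  Hence, with NO remaining hypothesis, for every `N ≥ 1` and every `d`:

* `SUN.haarActionBallLower N`, `SUN.haarActionBallUpper N` (the items, closed);
* `SUN.smallBalls N`, `SUN.onePlaquetteDecay N` ((H2), (H1) for `SU(N)`, `κ = N² - 1`);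
* `SUN.entropyGrowthLaw d N : SUN.EntropyGrowthLaw d N` — there is `C = C(d,N)` with, for all `L ≥ 2`,
  `β ≥ 1`, `(N²-1)·((d-1)·L^d·(1/2 - 1/L) - 1/2)·log β - C·L^d ≤ D(μ_{Λ,β}^{SU(N)} ‖ Haar^{⊗E})
  ≤ (N²-1)·((d-1)·L^d + 1)/2·log β + C·L^d`.  For `SU(3)`, `d = 4`: the relative entropy of the Wilson
  measure with respect to the product Haar prior — what every exact normalizing flow from the prior must
  supply as `log M + log J` (`Scaling/EntropyBudget.lean`) — is `12·L⁴·log β·(1 ± O(1/L)) ± C·L⁴`.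

Elementary; nothing here is cited as a fact.
-/

noncomputable section

namespace Summit.Ventures.LatticeQCDFlow.Theory2.Lattice.SUN

/-- **`SUN.HaarActionBallLower N` holds for every `N`** (OURS; `SUNHaar.haar_actionBall_ge`). [folklore] -/
theorem haarActionBallLower (N : ℕ) : HaarActionBallLower N := fun hN => by
  haveI : NeZero N := ⟨by omega⟩
  exact SUNHaar.haar_actionBall_ge

/-- **`SUN.HaarActionBallUpper N` holds for every `N`** (OURS; `SUNHaar.haar_actionBall_le`). [folklore] -/
theorem haarActionBallUpper (N : ℕ) : HaarActionBallUpper N := fun hN => by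
  haveI : NeZero N := ⟨by omega⟩
  exact SUNHaar.haar_actionBall_le

/-- **(H2) for `SU(N)`**, every `N` (`κ = N² - 1`). [folklore] -/
theorem smallBalls (N : ℕ) : SmallBalls N :=
  smallBalls_of_haarActionBallLower N (haarActionBallLower N)

/-- **(H1) for `SU(N)`**, every `N`: `Z₁(β) ≤ A·β^{-(N²-1)/2}`. [folklore] -/
theorem onePlaquetteDecay (N : ℕ) : OnePlaquetteDecay N :=
  onePlaquetteDecay_of_haarActionBallUpper N (haarActionBallUpper N)

/-- **The `SU(N)` entropy-growth law, unconditionally** (OURS; closes the typed item `SUN.EntropyGrowthLaw d N`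
for every `d` and `N ≥ 1`; for `SU(3)`, `d = 4` the leading coefficient is `12·L⁴` nats per unit of `log β`).
[folklore] -/
theorem entropyGrowthLaw (d N : ℕ) : EntropyGrowthLaw d N :=
  entropyGrowthLaw_of_haarActionBalls d N (haarActionBallLower N) (haarActionBallUpper N)

end Summit.Ventures.LatticeQCDFlow.Theory2.Lattice.SUN

end
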